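import Summits.CriticalPhenomena.PercolationContinuityZ3.Theorems.PercNearOneGluingNoHeavyQuantIntrinsicBallSteepness
import Literature.Probability.Percolation.SharpnessDCTProofs
import Literature.Probability.Percolation.ArmEvents
import HarnessLib

/-!
# THE CHEMICAL SPHERES: a Hammersley–Simon–Lieb inequality in the INTRINSIC metric,
# `P_p(0 ↔ ∂Λ_n) ≤ E_p|∂B_int(0,k)| · P_p(0 ↔ ∂Λ_{n-k})` (`1 ≤ k ≤ n`, every `p`, every `d`)
# — quant lane, seat p4 gen 39, file 1

builds on p205010 (kernel theorem, internal audit signed; external expert review pending) — NOT used in this file.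
Seat `prim-quant-p4`, `--supports stmt-CriticalPhenomena-4575`; pure proofs, no definitions (`local notation3` only).

`∂B_int(0,k)(ω) = Chemical.level (zdGraph d) 0 k ω` is the `k`-th CHEMICAL SPHERE of the open cluster of the origin (the sites at
open-graph distance exactly `k`), `B_int(0,k) = Chemical.ball (zdGraph d) 0 k ω` the intrinsic ball, and
`L_p(k) = Σ_{x ∈ Λ_k} P_p(x ∈ ∂B_int(0,k)) = E_p|∂B_int(0,k)|` its expected size (`∂B_int(0,k) ⊆ Λ_k`).  The one-arm
probability is `θ_n(p) = P_p(0 ↔ ∂Λ_n in Λ_n) = oneArmProb d p n`.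

* §1 `ChemSphere.mem_level_of_adj_of_notMem_ball`, **`ChemSphere.exists_level_exitEvent`** — the
  LAST EXIT of an arm from the intrinsic ball `B_int(0,k-1)`: if `0 ↔ ∂Λ_n` in `Λ_n` (`1 ≤ k ≤ n`, `ω ⊆ E(ℤ^d)`), the last vertex
  `a` of the arm in `B_int(0,k-1)` is followed by a site `b ∈ ∂B_int(0,k)` from which the arm runs to `∂Λ_n` inside
  `Λ_n ∖ B_int(0,k-1)` (Duminil-Copin–Tassion's exploration step with the deterministic set `S` replaced by the random chemical
  ball; Kozma–Nachmias' regeneration step).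
* §2 **`ChemSphere.determinedBy_ballLevel`** — `{B_int(0,k-1) = S, b ∈ ∂B_int(0,k)}` is read off the lattice edges touching `S`
  (locality of the intrinsic balls, `Chemical.ball_eq_of_agree`); these are disjoint from the pairs inside `Λ_n ∖ S` which carry
  the continuation, so the two are INDEPENDENT, and the continuation has probability `≤ θ_{n-k}(p)` (first exit + translation).
* §3 **`ChemSphere.real_siteToBoundary_le_sumLevel_mul`**, **`ChemSphere.oneArmProb_le_sumLevel_mul`** —
  `θ_n(p) ≤ L_p(k) · θ_{n-k}(p)` for `1 ≤ k ≤ n`; **`ChemSphere.oneArmProb_mul_le_sumLevel_pow`** — `θ_{mk}(p) ≤ L_p(k)^m`.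
  So ONE chemical sphere of expected size `< 1` forces exponential decay of the one-arm probability — the intrinsic twin of
  Hammersley's (1957) / Duminil-Copin–Tassion's `φ_p(S) < 1` criterion (tree: `DCT16.real_siteToBoundary_mul_le_pow`).

Files 2–3 draw the consequences: `E_p|∂B_int(0,k)| ≥ 1` for every `k` iff `p ≥ p_c`, `E_{p_c}|B_int(0,r)| ≥ r + 1` in EVERY
dimension (Kozma–Nachmias' Thm 1.3(i) lower half, there `d > 6` via the two-point function; here hypothesis-free and with the
mean-field-exact constant), a characterisation of `p_c` by the chemical spheres, and the near-critical windows.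

HONEST STATUS.  The inequality is NEW AS TYPED but its mechanism is printed: Hammersley's generation bound / the exploration step of
Duminil-Copin–Tassion 2016 §2.1 run with the random intrinsic ball in place of a fixed set (the Markov/regeneration property of the
chemical balls, Kozma–Nachmias 2009 §3.2, whose deterministic half is the tree's `ChemicalDistance.lean`).  NO rate, NO exponent for
`d = 3`; (T1)/(T2) and the lane's honest sentence UNCHANGED.

References: J. M. Hammersley, Ann. Math. Statist. 28 (1957) 790–795 (generation bound); H. Duminil-Copin, V. Tassion, Enseign. Math.
62 (2016) §2.1 [DuminilCopinTassionEM2016]; G. Kozma, A. Nachmias, Invent. Math. 178 (2009) §1.3, §3.2, Thm 1.3(i) [KozmaNachmias2009];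
G. Grimmett, Percolation (1999) §2.2 [GrimmettPercolation1999].
-/

noncomputable section

namespace Summit.CriticalPhenomena.PercolationContinuityZ3.Theorems

open MeasureTheory Set Filter Topology Literature.Probability.Percolation Literature.Probability.LatticeModels
open Literature.Probability.Percolation.Chemical Literature.Probability.Percolation.DCT16
open scoped Classical

namespace ChemSphere

variable {d : ℕ}

/-! ### §1. The last exit of an arm from the intrinsic ball `B_int(0, k-1)` -/

/-- The chemical sphere of radius `i` lies in the box `Λ_i`. [folklore] -/
theorem level_subset_box (i : ℕ) (ω : BondConfig (Site d)) : level (zdGraph d) 0 i ω ⊆ ↑(box d i) :=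
  (level_subset_ball _ _ _ _).trans (ChemRad.ball_subset_box i ω)

/-- The intrinsic ball is a finite set. [folklore] -/
theorem ball_finite (i : ℕ) (ω : BondConfig (Site d)) : (ball (zdGraph d) 0 i ω).Finite :=
  (box d i).finite_toSet.subset (ChemRad.ball_subset_box i ω)

/-- **One step out of `B_int(0,k-1)` lands on the sphere `∂B_int(0,k)`**: if `a ∈ B_int(0,k-1)`, `b ∉ B_int(0,k-1)` and the
lattice edge `ab` is open, then `b ∈ ∂B_int(0,k)`. [folklore] -/
theorem mem_level_of_adj_of_notMem_ball {ω : BondConfig (Site d)} (hω : ω ⊆ (zdGraph d).edgeSet) {k : ℕ} (hk : 1 ≤ k)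
    {a b : Site d} (ha : a ∈ ball (zdGraph d) 0 (k - 1) ω) (hb : b ∉ ball (zdGraph d) 0 (k - 1) ω)
    (hab : (openGraph ω).Adj a b) : b ∈ level (zdGraph d) 0 k ω := by
  obtain ⟨w, hw⟩ := ha
  have hab' : (openGraph ω ⊓ zdGraph d).Adj a b := (SimpleGraph.inf_adj _ _ _ _).2 ⟨hab, adj_of_openGraph_adj hω hab⟩
  have hreach : (openGraph ω ⊓ zdGraph d).Reachable 0 b := ⟨w.concat hab'⟩
  have hle : (openGraph ω ⊓ zdGraph d).dist 0 b ≤ k := by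
    have := SimpleGraph.dist_le (w.concat hab')
    rw [SimpleGraph.Walk.length_concat] at this
    omega
  have hge : k ≤ (openGraph ω ⊓ zdGraph d).dist 0 b := by
    by_contra hlt
    exact hb (mem_ball_iff.2 ⟨hreach, by omega⟩)
  exact ⟨hreach, le_antisymm hle hge⟩

/-- **THE LAST EXIT FROM THE INTRINSIC BALL** (Duminil-Copin–Tassion's exploration step in the chemical metric): for
`ω ⊆ E(ℤ^d)` with `0 ↔ ∂Λ_n` in `Λ_n` and `1 ≤ k ≤ n`, writing `S = B_int(0,k-1)(ω)` (a finite set of sites), some site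
`b ∈ Λ_k` lies on the chemical sphere `∂B_int(0,k)(ω)` and is joined to `∂Λ_n` by an open path inside `Λ_n ∖ S`
(`DCT16.exitEvent n S b`): follow the arm up to its last visit to `S`. [cite: DuminilCopinTassionEM2016, §2.1 (exploration step)] -/
theorem exists_level_exitEvent {ω : BondConfig (Site d)} (hω : ω ⊆ (zdGraph d).edgeSet) {k n : ℕ} (hk : 1 ≤ k)
    (hkn : k ≤ n) (h : ω ∈ siteToBoundary d n) :
    ∃ b ∈ box d k, b ∈ level (zdGraph d) 0 k ω ∧ ω ∈ exitEvent n (ball_finite (k - 1) ω).toFinset b := by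
  rw [mem_siteToBoundary_iff] at h
  obtain ⟨z, hz, hpath⟩ := h
  set C : Set (Site d) := ball (zdGraph d) 0 (k - 1) ω with hC
  have h0 : (0 : Site d) ∈ C := self_mem_ball _ _ _ _
  have hzC : z ∉ C := fun hzC =>
    notMem_box_of_mem_innerBoundary_box (show k - 1 < n by omega) hz (ChemRad.ball_subset_box (k - 1) ω hzC)
  obtain ⟨a, b, haC, -, hbC, hab, hbz⟩ := hpath.last_exit h0 hzC
  have hblev : b ∈ level (zdGraph d) 0 k ω := mem_level_of_adj_of_notMem_ball hω hk haC hbC hab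
  refine ⟨b, level_subset_box k ω hblev, hblev, z, hz, ?_⟩
  rw [mem_openConnIn_iff_pathIn]
  have hcoe : (↑(box d n) : Set (Site d)) \ ↑(ball_finite (k - 1) ω).toFinset = ↑(box d n) \ C := by
    rw [Set.Finite.coe_toFinset]
  rw [hcoe]
  exact hbz

/-! ### §2. Locality and independence -/

/-- The lattice edges touching `S`, as a set: the edges of `ℤ^d` having an endpoint in `S`. [folklore] -/
theorem coe_edgesTouching (S : Finset (Site d)) :
    (↑(edgesTouching (zdGraph d) S) : Set (Sym2 (Site d))) = {e | e ∈ (zdGraph d).edgeSet ∧ ∃ y ∈ (↑S : Set (Site d)), y ∈ e} := by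
  ext e
  simp only [Finset.mem_coe, mem_edgesTouching_iff, Set.mem_setOf_eq]

/-- `BL[k, S, b]`: the event `{B_int(0,k-1) = S and b ∈ ∂B_int(0,k)}` (the value of the explored ball and one site of the next sphere). -/
local notation3 "BL[" k ", " S ", " b "]" =>
  ({ω : BondConfig (Site d) | ball (zdGraph d) 0 (k - 1) ω = (↑S : Set (Site d))} ∩
    {ω : BondConfig (Site d) | b ∈ level (zdGraph d) 0 k ω})

/-- **LOCALITY**: `{B_int(0,k-1) = S, b ∈ ∂B_int(0,k)}` is determined by the lattice edges touching `S` (the balls of radius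
`≤ k` are read off the edges touching the ball of radius `k - 1`, `Chemical.ball_eq_of_agree` / `level_eq_of_agree`).
[cite: KozmaNachmias2009, §3.2 (edges needed to calculate B(0,j;G))] -/
theorem determinedBy_ballLevel {k : ℕ} (hk : 1 ≤ k) (S : Finset (Site d)) (b : Site d) :
    DeterminedBy BL[k, S, b] (↑(edgesTouching (zdGraph d) S) : Set (Sym2 (Site d))) := by
  rw [determinedBy_iff]
  suffices key : ∀ ω ω' : BondConfig (Site d),
      ω ∩ ↑(edgesTouching (zdGraph d) S) = ω' ∩ ↑(edgesTouching (zdGraph d) S) → ω ∈ BL[k, S, b] → ω' ∈ BL[k, S, b] from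
    fun ω ω' h => ⟨key ω ω' h, key ω' ω h.symm⟩
  rintro ω ω' h ⟨hS, hb⟩
  have hS' : ball (zdGraph d) 0 (k - 1) ω = ↑S := hS
  have hagree : ∀ e ∈ (zdGraph d).edgeSet, (∃ y ∈ ball (zdGraph d) 0 (k - 1) ω, y ∈ e) → (e ∈ ω ↔ e ∈ ω') := by
    intro e he hy
    rw [hS'] at hy
    have hmem : e ∈ (↑(edgesTouching (zdGraph d) S) : Set (Sym2 (Site d))) := by
      rw [coe_edgesTouching]; exact ⟨he, hy⟩
    constructor
    · intro heω
      have : e ∈ ω' ∩ ↑(edgesTouching (zdGraph d) S) := h ▸ ⟨heω, hmem⟩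
      exact this.1
    · intro heω'
      have : e ∈ ω ∩ ↑(edgesTouching (zdGraph d) S) := h.symm ▸ ⟨heω', hmem⟩
      exact this.1
  refine ⟨?_, ?_⟩
  · show ball (zdGraph d) 0 (k - 1) ω' = ↑S
    rw [ball_eq_of_agree hagree (by omega), hS']
  · show b ∈ level (zdGraph d) 0 k ω'
    rw [level_eq_of_agree hagree (i := k) (by omega)]
    exact hb

/-- `{B_int(0,k-1) = S, b ∈ ∂B_int(0,k)}` is measurable. [folklore] -/
theorem measurableSet_ballLevel {k : ℕ} (hk : 1 ≤ k) (S : Finset (Site d)) (b : Site d) : MeasurableSet BL[k, S, b] :=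
  (determinedBy_ballLevel hk S b).measurableSet_of_finset

/-- The lattice edges touching `S` are disjoint from the pairs inside `Λ_n ∖ S`. [folklore] -/
theorem disjoint_edgesTouching_sym2_sdiff (S : Finset (Site d)) (n : ℕ) :
    Disjoint (edgesTouching (zdGraph d) S) ((box d n \ S).sym2) := by
  rw [Finset.disjoint_left]
  intro e he he'
  rw [mem_edgesTouching_iff] at he
  obtain ⟨-, y, hyS, hye⟩ := he
  have := Finset.mem_sym2_iff.1 he' y hye
  rw [Finset.mem_sdiff] at this
  exact this.2 hyS

/-- **INDEPENDENCE**: `P_p({B_int(0,k-1) = S, b ∈ ∂B_int(0,k)} ∩ {b ↔ ∂Λ_n in Λ_n ∖ S}) = P_p(first) · P_p(second)` — the two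
events read disjoint sets of pairs. [cite: DuminilCopinTassionEM2016, §2.1 (the events depend on different sets of edges)] -/
theorem real_ballLevel_inter_exitEvent (p : unitInterval) {k : ℕ} (hk : 1 ≤ k) (S : Finset (Site d)) (b : Site d) (n : ℕ) :
    (bondPercolation (zdGraph d) p).real (BL[k, S, b] ∩ exitEvent n S b) =
      (bondPercolation (zdGraph d) p).real BL[k, S, b] * (bondPercolation (zdGraph d) p).real (exitEvent n S b) :=
  real_inter_of_determinedBy_disjoint (zdGraph d) p (determinedBy_ballLevel hk S b) (determinedBy_exitEvent n S b)
    (disjoint_edgesTouching_sym2_sdiff S n)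

/-- **THE CONTINUATION COSTS `θ_{n-k}`**: for `b ∈ Λ_k` and `k ≤ n`, `P_p(b ↔ ∂Λ_n in Λ_n ∖ S) ≤ P_p(0 ↔ ∂Λ_{n-k})` (a site of
`∂Λ_n` is not in the interior of `b + Λ_{n-k}`: first exit gives the translated arm event, then translation invariance).
[cite: DuminilCopinTassionEM2016, §2.1 (P_p[y ↔ ∂Λ_{kL} off 𝒞] ≤ P_p[0 ↔ ∂Λ_{(k-1)L}])] -/
theorem real_exitEvent_le (p : unitInterval) {k n : ℕ} (hk : 1 ≤ k) (hkn : k ≤ n) (S : Finset (Site d)) {b : Site d}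
    (hb : b ∈ box d k) :
    (bondPercolation (zdGraph d) p).real (exitEvent n S b) ≤ (bondPercolation (zdGraph d) p).real (siteToBoundary d (n - k)) := by
  rw [← real_armEvent p b (n - k)]
  refine real_mono_of_forall_subset_edgeSet (zdGraph d) p fun ω hω h => ?_
  have hn : n = (n - k) + (k - 1) + 1 := by omega
  rw [hn] at h
  exact armEvent_of_mem_exitEvent (by rwa [Nat.sub_add_cancel hk]) hω h

/-! ### §3. The submultiplicativity inequality -/

/-- `L_p(k) = Σ_{x ∈ Λ_k} P_p(x ∈ ∂B_int(0,k)) = E_p|∂B_int(0,k)|`, the expected size of the `k`-th chemical sphere. -/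
local notation3 "SL[" p ", " k "]" =>
  ∑ x ∈ box d k, (bondPercolation (zdGraph d) p).real {ω : BondConfig (Site d) | x ∈ level (zdGraph d) 0 k ω}

/-- `L_p(k) ≥ 0`. [folklore] -/
theorem sumLevel_nonneg (p : unitInterval) (k : ℕ) : 0 ≤ SL[p, k] :=
  Finset.sum_nonneg fun _ _ => measureReal_nonneg

/-- **PARTITION BY THE VALUE OF THE EXPLORED BALL**: `Σ_{S ⊆ Λ_{k-1}} P_p(B_int(0,k-1) = S, b ∈ ∂B_int(0,k)) = P_p(b ∈ ∂B_int(0,k))`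
(the ball of radius `k - 1` is a subset of `Λ_{k-1}`, and distinct values give disjoint events). [folklore] -/
theorem sum_real_ballLevel (p : unitInterval) {k : ℕ} (hk : 1 ≤ k) (b : Site d) :
    ∑ S ∈ (box d (k - 1)).powerset, (bondPercolation (zdGraph d) p).real BL[k, S, b] =
      (bondPercolation (zdGraph d) p).real {ω : BondConfig (Site d) | b ∈ level (zdGraph d) 0 k ω} := by
  rw [← measureReal_biUnion_finset]
  · congr 1
    ext ω
    simp only [Set.mem_iUnion, Set.mem_inter_iff, Set.mem_setOf_eq, exists_prop, Finset.mem_powerset]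
    constructor
    · rintro ⟨S, -, -, hb⟩; exact hb
    · intro hb
      refine ⟨(ball_finite (k - 1) ω).toFinset, ?_, ?_, hb⟩
      · rw [← Finset.coe_subset, Set.Finite.coe_toFinset]; exact ChemRad.ball_subset_box (k - 1) ω
      · rw [Set.Finite.coe_toFinset]
  · intro S _ S' _ hne
    rw [Function.onFun, Set.disjoint_left]
    rintro ω ⟨hS, -⟩ ⟨hS', -⟩
    exact hne (Finset.coe_injective ((hS : ball (zdGraph d) 0 (k - 1) ω = ↑S).symm.trans hS'))
  · exact fun S _ => measurableSet_ballLevel hk S b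

/-- **THE CHEMICAL-SPHERE SUBMULTIPLICATIVITY INEQUALITY**: for every `p`, every `d` and `1 ≤ k ≤ n`,
`P_p(0 ↔ ∂Λ_n) ≤ (Σ_{x ∈ Λ_k} P_p(x ∈ ∂B_int(0,k))) · P_p(0 ↔ ∂Λ_{n-k})`, i.e. `θ_n(p) ≤ E_p|∂B_int(0,k)| · θ_{n-k}(p)` — the
`k`-th chemical sphere plays the part of the `k`-th generation of a branching process (Hammersley's bound), or of the boundary of
Duminil-Copin–Tassion's set `S` (with `φ_p(S)` replaced by the expected sphere size).  Proof: last exit from `B_int(0,k-1)` (§1),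
union bound over the value `S` of that ball and the exit site `b ∈ ∂B_int(0,k)`, independence (§2), translation.
[cite: DuminilCopinTassionEM2016, §2.1 (exploration step)] -/
theorem real_siteToBoundary_le_sumLevel_mul (p : unitInterval) {k n : ℕ} (hk : 1 ≤ k) (hkn : k ≤ n) :
    (bondPercolation (zdGraph d) p).real (siteToBoundary d n) ≤
      SL[p, k] * (bondPercolation (zdGraph d) p).real (siteToBoundary d (n - k)) := by
  set P := bondPercolation (zdGraph d) p with hP
  set I := (box d (k - 1)).powerset with hI
  set θ' := P.real (siteToBoundary d (n - k)) with hθ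
  -- covering by the pieces
  have hcover : P.real (siteToBoundary d n) ≤ P.real (⋃ S ∈ I, ⋃ b ∈ box d k, (BL[k, S, b] ∩ exitEvent n S b)) := by
    refine real_mono_of_forall_subset_edgeSet (zdGraph d) p fun ω hω h => ?_
    obtain ⟨b, hb, hblev, hexit⟩ := exists_level_exitEvent hω hk hkn h
    rw [Set.mem_iUnion₂]
    refine ⟨(ball_finite (k - 1) ω).toFinset, ?_, ?_⟩
    · rw [hI, Finset.mem_powerset, ← Finset.coe_subset, Set.Finite.coe_toFinset]; exact ChemRad.ball_subset_box (k - 1) ω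
    · rw [Set.mem_iUnion₂]
      exact ⟨b, hb, ⟨by simp only [Set.mem_setOf_eq, Set.Finite.coe_toFinset], hblev⟩, hexit⟩
  -- the double sum
  calc P.real (siteToBoundary d n)
      ≤ P.real (⋃ S ∈ I, ⋃ b ∈ box d k, (BL[k, S, b] ∩ exitEvent n S b)) := hcover
    _ ≤ ∑ S ∈ I, P.real (⋃ b ∈ box d k, (BL[k, S, b] ∩ exitEvent n S b)) := measureReal_biUnion_finset_le _ _
    _ ≤ ∑ S ∈ I, ∑ b ∈ box d k, P.real (BL[k, S, b] ∩ exitEvent n S b) :=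
        Finset.sum_le_sum fun S _ => measureReal_biUnion_finset_le _ _
    _ = ∑ S ∈ I, ∑ b ∈ box d k, P.real BL[k, S, b] * P.real (exitEvent n S b) :=
        Finset.sum_congr rfl fun S _ => Finset.sum_congr rfl fun b _ => real_ballLevel_inter_exitEvent p hk S b n
    _ ≤ ∑ S ∈ I, ∑ b ∈ box d k, P.real BL[k, S, b] * θ' :=
        Finset.sum_le_sum fun S _ => Finset.sum_le_sum fun b hb =>
          mul_le_mul_of_nonneg_left (real_exitEvent_le p hk hkn S hb) measureReal_nonneg
    _ = (∑ b ∈ box d k, ∑ S ∈ I, P.real BL[k, S, b]) * θ' := by rw [Finset.sum_comm, Finset.sum_mul]; simp_rw [Finset.sum_mul]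
    _ = SL[p, k] * θ' := by
        congr 1
        exact Finset.sum_congr rfl fun b _ => sum_real_ballLevel p hk b

/-- **`θ_n(p) ≤ E_p|∂B_int(0,k)| · θ_{n-k}(p)`** in the tree's one-arm vocabulary (`oneArmProb d p n = P_p(0 ↔ ∂Λ_n)`), `1 ≤ k ≤ n`.
[cite: DuminilCopinTassionEM2016, §2.1 (exploration step)] -/
theorem oneArmProb_le_sumLevel_mul (p : unitInterval) {k n : ℕ} (hk : 1 ≤ k) (hkn : k ≤ n) :
    oneArmProb d p n ≤ SL[p, k] * oneArmProb d p (n - k) :=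
  real_siteToBoundary_le_sumLevel_mul p hk hkn

/-- **ITERATED: `θ_{mk}(p) ≤ (E_p|∂B_int(0,k)|)^m`** for every `m` and `k ≥ 1` (Hammersley's generation bound in the chemical
metric: the one-arm probability to extrinsic distance `mk` is at most the `m`-th power of the expected size of the `k`-th chemical
sphere).  In particular ONE chemical sphere of expected size `< 1` forces exponential decay of `θ_n(p)`.
[cite: DuminilCopinTassionEM2016, §2.1 (iteration of the exploration step)] -/
theorem oneArmProb_mul_le_sumLevel_pow (p : unitInterval) {k : ℕ} (hk : 1 ≤ k) (m : ℕ) :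
    oneArmProb d p (m * k) ≤ SL[p, k] ^ m := by
  induction m with
  | zero => rw [zero_mul, pow_zero]; exact measureReal_le_one
  | succ m ih =>
    have h := oneArmProb_le_sumLevel_mul (d := d) p hk (show k ≤ (m + 1) * k by nlinarith)
    rw [show (m + 1) * k - k = m * k by rw [Nat.add_mul, one_mul, Nat.add_sub_cancel]] at h
    calc oneArmProb d p ((m + 1) * k) ≤ SL[p, k] * oneArmProb d p (m * k) := h
      _ ≤ SL[p, k] * SL[p, k] ^ m := mul_le_mul_of_nonneg_left ih (sumLevel_nonneg p k)
      _ = SL[p, k] ^ (m + 1) := by ring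

/-- **Exponential decay from one small sphere**: if `E_p|∂B_int(0,k)| ≤ s` (`k ≥ 1`, `0 ≤ s`) then `θ_n(p) ≤ s^{⌊n/k⌋}` for every
`n` (monotonicity of `θ_n` in `n`). [cite: DuminilCopinTassionEM2016, §2.1] -/
theorem oneArmProb_le_pow_div (p : unitInterval) {k : ℕ} (hk : 1 ≤ k) {s : ℝ} (hs : SL[p, k] ≤ s) (n : ℕ) :
    oneArmProb d p n ≤ s ^ (n / k) := by
  have h0 : 0 ≤ SL[p, k] := sumLevel_nonneg p k
  calc oneArmProb d p n ≤ oneArmProb d p (n / k * k) := real_siteToBoundary_antitone p (Nat.div_mul_le_self n k)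
    _ ≤ SL[p, k] ^ (n / k) := oneArmProb_mul_le_sumLevel_pow p hk (n / k)
    _ ≤ s ^ (n / k) := pow_le_pow_left₀ h0 hs _

end ChemSphere

end Summit.CriticalPhenomena.PercolationContinuityZ3.Theorems

end
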